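import Summits.AnomalousDissipation.AnomalousDissipation.Theorems.SoloBlindEnergyFloorLH
import Literature.Analysis.FluidPDE.LerayHopfMomentum

/-!
# Solo (blind) — the Reynolds-stress moment of an `L²` slice at ANY momentum

Slice-level half of the free-momentum dissipation floor (`SoloBlindDissipationFloorLH`).
Doering & Foias (J. Fluid Mech. 467 (2002), §3) bound the stress moment
`A = ∫ u⊗u : ∇Ψ` of a MEAN-ZERO field by `‖Ψ‖_∞‖u‖₂‖∇u‖₂` (derivative moved onto `u`, then
Poincaré). The statement `Literature.Turb.ZerothLaw` leaves the momentum `m = ∫u` free, and at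
`m ≠ 0` Poincaré fails; here we split `u = m + u'`, observe that the `m ⊗ m` part of the stress
does no work on a periodic multiplier (`∫⟪w,(m·∇)Ψ⟫ = 0`), bound the two cross terms by Young,
and use `|m|² ≤ ‖u‖₂²` together with Poincaré WITH MEAN `‖u - m‖₂² ≤ ‖∇u‖₂²`
(`Literature.Analysis.FluidPDE.Torus.integral_norm_sq_le_add_toReal_eGradNormSq`): for every
`η > 0` and every `L²` slice `U` with finite spectral Dirichlet form,

  `∫ U⊗U : ∇Ψ ≥ -(M η ‖U‖₂² + (M/η) ‖∇U‖₂²)`,  `M = sup |∇Ψ|_F`   (`stressMoment_ge_dissipation_slice`).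

[cite: DoeringFoias2002, §3] [cite: FoiasManleyRosaTemam2001, Ch. II §1.1, Ch. IV §3.1]
-/

open MeasureTheory Filter Topology Set UnitAddTorus
open scoped ENNReal NNReal InnerProductSpace

noncomputable section

namespace Summit.AnomalousDissipation.AnomalousDissipation.Theorems

open Literature.Analysis.FunctionSpaces Literature.Analysis.FunctionSpaces.Torus
open Literature.Analysis.FluidPDE

variable {ν η M T : ℝ} {f Ψ u₀ : UnitAddTorus (Fin 3) → EuclideanSpace ℝ (Fin 3)}
  {u : ℝ → UnitAddTorus (Fin 3) → EuclideanSpace ℝ (Fin 3)}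

/-! ### Pointwise algebra of the stress integrand -/

/-- Young's inequality in the form `ab ≤ (η/2)a² + b²/(2η)` (`η > 0`). [folklore] -/
theorem mul_le_young_eta {a b η : ℝ} (hη : 0 < η) :
    a * b ≤ η / 2 * a ^ 2 + b ^ 2 / (2 * η) := by
  rw [← sub_nonneg]
  have h : η / 2 * a ^ 2 + b ^ 2 / (2 * η) - a * b = (η * a - b) ^ 2 / (2 * η) := by
    field_simp
    ring
  rw [h]
  positivity

/-- Frobenius bound on the transport term: `|⟪w, (V·∇)Ψ(x)⟫| ≤ M ‖w‖ ‖V(x)‖` whenever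
`|∇Ψ| ≤ M` pointwise (Frobenius norm). [folklore] -/
theorem abs_inner_convect_le_frobenius (hΨ : IsSmooth Ψ)
    (hM : ∀ x, Real.sqrt (∑ i, ‖Torus.partialDeriv i Ψ x‖ ^ 2) ≤ M)
    (V : UnitAddTorus (Fin 3) → EuclideanSpace ℝ (Fin 3)) (w : EuclideanSpace ℝ (Fin 3))
    (x : UnitAddTorus (Fin 3)) :
    |⟪w, Torus.convect V Ψ x⟫_ℝ| ≤ M * (‖w‖ * ‖V x‖) := by
  have h1 := abs_real_inner_le_norm w (Torus.convect V Ψ x)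
  have h2 := Torus.norm_convect_le_norm_mul_sqrt (hΨ.isContDiff (by simp)) V x
  calc |⟪w, Torus.convect V Ψ x⟫_ℝ| ≤ ‖w‖ * ‖Torus.convect V Ψ x‖ := h1
    _ ≤ ‖w‖ * (‖V x‖ * Real.sqrt (∑ i, ‖Torus.partialDeriv i Ψ x‖ ^ 2)) :=
        mul_le_mul_of_nonneg_left h2 (norm_nonneg _)
    _ ≤ ‖w‖ * (‖V x‖ * M) :=
        mul_le_mul_of_nonneg_left (mul_le_mul_of_nonneg_left (hM x) (norm_nonneg _))
          (norm_nonneg _)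
    _ = M * (‖w‖ * ‖V x‖) := by ring

/-- The transport term is affine in the transporting field: subtracting a constant vector `m`,
`(V·∇)Ψ = ((V - m)·∇)Ψ + (m·∇)Ψ` pointwise. [folklore] -/
theorem convect_eq_convect_sub_const_add (hΨ : IsSmooth Ψ)
    (V : UnitAddTorus (Fin 3) → EuclideanSpace ℝ (Fin 3)) (m : EuclideanSpace ℝ (Fin 3))
    (x : UnitAddTorus (Fin 3)) :
    Torus.convect V Ψ x =
      Torus.convect (fun y => V y - m) Ψ x + Torus.convect (fun _ => m) Ψ x := by
  have hc : IsContDiff 1 Ψ := hΨ.isContDiff (by simp)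
  rw [Torus.convect_eq_sum_smul_partialDeriv hc, Torus.convect_eq_sum_smul_partialDeriv hc,
    Torus.convect_eq_sum_smul_partialDeriv hc, ← Finset.sum_add_distrib]
  refine Finset.sum_congr rfl fun i _ => ?_
  rw [← add_smul]
  congr 1
  simp

/-- The `m ⊗ m` part of the stress does no work on a periodic multiplier:
`∫⟪w, (m·∇)Ψ⟫ = 0` for constant vectors `m, w` (`∫ ∂ᵢΨ = 0`). [folklore] -/
theorem integral_inner_convect_const_eq_zero (hΨ : IsSmooth Ψ) (m w : EuclideanSpace ℝ (Fin 3)) :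
    ∫ x, ⟪w, Torus.convect (fun _ => m) Ψ x⟫_ℝ = 0 := by
  have hc : IsContDiff 1 Ψ := hΨ.isContDiff (by simp)
  have hrw : (fun x => ⟪w, Torus.convect (fun _ => m) Ψ x⟫_ℝ) =
      fun x => ∑ i, m i * ⟪w, Torus.partialDeriv i Ψ x⟫_ℝ := by
    funext x
    rw [Torus.convect_eq_sum_smul_partialDeriv hc, inner_sum]
    refine Finset.sum_congr rfl fun i _ => ?_
    rw [real_inner_smul_right]
  have hint : ∀ i, Integrable (fun x => ⟪w, Torus.partialDeriv i Ψ x⟫_ℝ) volume := fun i =>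
    Torus.integrable_inner_of_continuous (integrable_const w) (hΨ.partialDeriv i).continuous
  rw [hrw, integral_finsetSum _ fun i _ => (hint i).const_mul (m i)]
  refine Finset.sum_eq_zero fun i _ => ?_
  rw [integral_const_mul, integral_inner (hΨ.partialDeriv i).integrable w,
    Torus.integral_partialDeriv_eq_zero_holds hΨ i, inner_zero_right, mul_zero]

/-- **Stress integrand against a constant shift.** For `U ∈ L²`, every constant vector `m` and
every `η > 0`:
`∫⟪U,(U·∇)Ψ⟫ ≥ -M (η/2 (‖U‖₂² + |m|²) + η⁻¹ ‖U - m‖₂²)` (`|∇Ψ| ≤ M`): split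
`(U·∇)Ψ = ((U-m)·∇)Ψ + (m·∇)Ψ`, `U = (U - m) + m`, drop the `m ⊗ m` term (zero integral) and use
Young on the two cross terms. [folklore] -/
theorem integral_inner_convect_ge_of_const {U : UnitAddTorus (Fin 3) → EuclideanSpace ℝ (Fin 3)}
    (hU : MemLp U 2 volume) (hΨ : IsSmooth Ψ)
    (hM : ∀ x, Real.sqrt (∑ i, ‖Torus.partialDeriv i Ψ x‖ ^ 2) ≤ M) (hη : 0 < η)
    (m : EuclideanSpace ℝ (Fin 3)) :
    -(M * (η / 2 * ((∫ x, ‖U x‖ ^ 2) + ‖m‖ ^ 2) + η⁻¹ * ∫ x, ‖U x - m‖ ^ 2)) ≤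
      ∫ x, ⟪U x, Torus.convect U Ψ x⟫_ℝ := by
  have hM0 : 0 ≤ M := (Real.sqrt_nonneg _).trans (hM 0)
  -- the three pieces of the integrand
  set t3 : UnitAddTorus (Fin 3) → ℝ := fun x => ⟪m, Torus.convect (fun _ => m) Ψ x⟫_ℝ with ht3
  set g : UnitAddTorus (Fin 3) → ℝ := fun x =>
    -(M * (η / 2 * (‖U x‖ ^ 2 + ‖m‖ ^ 2) + η⁻¹ * ‖U x - m‖ ^ 2)) with hg
  have hsplit : ∀ x, ⟪U x, Torus.convect U Ψ x⟫_ℝ =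
      ⟪U x, Torus.convect (fun y => U y - m) Ψ x⟫_ℝ +
        ⟪U x - m, Torus.convect (fun _ => m) Ψ x⟫_ℝ + t3 x := by
    intro x
    calc ⟪U x, Torus.convect U Ψ x⟫_ℝ
        = ⟪U x, Torus.convect (fun y => U y - m) Ψ x + Torus.convect (fun _ => m) Ψ x⟫_ℝ := by
          rw [convect_eq_convect_sub_const_add hΨ U m x]
      _ = ⟪U x, Torus.convect (fun y => U y - m) Ψ x⟫_ℝ +
            ⟪U x - m + m, Torus.convect (fun _ => m) Ψ x⟫_ℝ := by
          rw [inner_add_right, sub_add_cancel]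
      _ = _ := by
          rw [inner_add_left]
          simp only [ht3]
          ring
  -- pointwise lower bound of the integrand by `g + t3`
  have hpt : ∀ x, g x + t3 x ≤ ⟪U x, Torus.convect U Ψ x⟫_ℝ := by
    intro x
    rw [hsplit x]
    have h1 := abs_inner_convect_le_frobenius hΨ hM (fun y => U y - m) (U x) x
    have h2 := abs_inner_convect_le_frobenius hΨ hM (fun _ => m) (U x - m) x
    have y1 : ‖U x‖ * ‖U x - m‖ ≤ η / 2 * ‖U x‖ ^ 2 + ‖U x - m‖ ^ 2 / (2 * η) :=
      mul_le_young_eta hη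
    have y2 : ‖m‖ * ‖U x - m‖ ≤ η / 2 * ‖m‖ ^ 2 + ‖U x - m‖ ^ 2 / (2 * η) :=
      mul_le_young_eta hη
    have e1 : -(M * (‖U x‖ * ‖U x - m‖)) ≤ ⟪U x, Torus.convect (fun y => U y - m) Ψ x⟫_ℝ := by
      have := (abs_le.1 h1).1
      simpa using this
    have e2 : -(M * (‖U x - m‖ * ‖m‖)) ≤ ⟪U x - m, Torus.convect (fun _ => m) Ψ x⟫_ℝ :=
      (abs_le.1 h2).1
    have y1' := mul_le_mul_of_nonneg_left y1 hM0
    have y2' := mul_le_mul_of_nonneg_left y2 hM0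
    have hid : g x = -(M * (η / 2 * ‖U x‖ ^ 2 + ‖U x - m‖ ^ 2 / (2 * η)) +
        M * (η / 2 * ‖m‖ ^ 2 + ‖U x - m‖ ^ 2 / (2 * η))) := by
      rw [hg]
      field_simp
      ring
    rw [hid]
    nlinarith [mul_comm (‖U x - m‖) ‖m‖]
  -- integrability
  have hUi : Integrable U volume := hU.integrable one_le_two
  have hU' : MemLp (fun x => U x - m) 2 volume := hU.sub (memLp_const m)
  have hint : Integrable (fun x => ⟪U x, Torus.convect U Ψ x⟫_ℝ) volume :=
    Torus.integrable_inner_convect_self hU hΨ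
  have hE0i : Integrable (fun x => ‖U x‖ ^ 2) volume := hU.integrable_norm_pow two_ne_zero
  have hVi : Integrable (fun x => ‖U x - m‖ ^ 2) volume := hU'.integrable_norm_pow two_ne_zero
  have hc : IsContDiff 1 Ψ := hΨ.isContDiff (by simp)
  have ht3i : Integrable t3 volume := by
    have hrw : t3 = fun x => ∑ i, m i * ⟪m, Torus.partialDeriv i Ψ x⟫_ℝ := by
      funext x
      rw [ht3]
      dsimp only
      rw [Torus.convect_eq_sum_smul_partialDeriv hc, inner_sum]
      refine Finset.sum_congr rfl fun i _ => ?_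
      rw [real_inner_smul_right]
    rw [hrw]
    exact integrable_finsetSum _ fun i _ =>
      (Torus.integrable_inner_of_continuous (integrable_const m)
        (hΨ.partialDeriv i).continuous).const_mul (m i)
  have hgi : Integrable g volume := by
    have h1 : Integrable (fun x => η / 2 * (‖U x‖ ^ 2 + ‖m‖ ^ 2)) volume :=
      (hE0i.add (integrable_const _)).const_mul _
    have h2 : Integrable (fun x => η⁻¹ * ‖U x - m‖ ^ 2) volume := hVi.const_mul _
    exact ((h1.add h2).const_mul M).neg
  -- integrate
  have hmono : ∫ x, (g x + t3 x) ≤ ∫ x, ⟪U x, Torus.convect U Ψ x⟫_ℝ :=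
    integral_mono (hgi.add ht3i) hint hpt
  have ht3z : ∫ x, t3 x = 0 := integral_inner_convect_const_eq_zero hΨ m m
  have hgval : ∫ x, g x =
      -(M * (η / 2 * ((∫ x, ‖U x‖ ^ 2) + ‖m‖ ^ 2) + η⁻¹ * ∫ x, ‖U x - m‖ ^ 2)) := by
    have h1 : Integrable (fun x => η / 2 * (‖U x‖ ^ 2 + ‖m‖ ^ 2)) volume :=
      (hE0i.add (integrable_const _)).const_mul _
    have h2 : Integrable (fun x => η⁻¹ * ‖U x - m‖ ^ 2) volume := hVi.const_mul _
    rw [hg]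
    dsimp only
    rw [integral_neg, integral_const_mul, integral_add h1 h2, integral_const_mul,
      integral_const_mul, integral_add hE0i (integrable_const _), integral_const, probReal_univ,
      one_smul]
  rw [integral_add hgi ht3i, ht3z, add_zero, hgval] at hmono
  exact hmono

/-- **The stress moment of an `L²` slice with finite dissipation, at ANY momentum**: for every
`η > 0`, `∫ U⊗U : ∇Ψ ≥ -(M η ‖U‖₂² + (M/η) ‖∇U‖₂²)` (`|∇Ψ| ≤ M`; `‖∇U‖₂²` the spectral
`eGradNormSq`, Poincaré with mean `‖U - ∫U‖₂² ≤ ‖∇U‖₂²`, and `|∫U|² ≤ ‖U‖₂²`).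
[cite: DoeringFoias2002, §3] -/
theorem stressMoment_ge_dissipation_slice {U : UnitAddTorus (Fin 3) → EuclideanSpace ℝ (Fin 3)}
    (hU : MemLp U 2 volume) (hG : Torus.eGradNormSq U ≠ ⊤) (hΨ : IsSmooth Ψ)
    (hM : ∀ x, Real.sqrt (∑ i, ‖Torus.partialDeriv i Ψ x‖ ^ 2) ≤ M) (hη : 0 < η) :
    -(M * η * (∫ x, ‖U x‖ ^ 2) + M / η * (Torus.eGradNormSq U).toReal) ≤
      ∫ x, ⟪U x, Torus.convect U Ψ x⟫_ℝ := by
  have hM0 : 0 ≤ M := (Real.sqrt_nonneg _).trans (hM 0)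
  have h := integral_inner_convect_ge_of_const hU hΨ hM hη (∫ y, U y)
  have hvar := Literature.Analysis.FluidPDE.Torus.integral_norm_sub_integral_sq hU
  have hP := Literature.Analysis.FluidPDE.Torus.integral_norm_sq_le_add_toReal_eGradNormSq hU hG
  have hV0 : 0 ≤ ∫ x, ‖U x - ∫ y, U y‖ ^ 2 := integral_nonneg fun _ => sq_nonneg _
  have hm : ‖∫ y, U y‖ ^ 2 ≤ ∫ x, ‖U x‖ ^ 2 := by linarith
  have hVG : ∫ x, ‖U x - ∫ y, U y‖ ^ 2 ≤ (Torus.eGradNormSq U).toReal := by linarith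
  have hE0 : 0 ≤ ∫ x, ‖U x‖ ^ 2 := integral_nonneg fun _ => sq_nonneg _
  refine le_trans ?_ h
  have i1 : η / 2 * ((∫ x, ‖U x‖ ^ 2) + ‖∫ y, U y‖ ^ 2) ≤ η * ∫ x, ‖U x‖ ^ 2 := by nlinarith
  have i2 : η⁻¹ * ∫ x, ‖U x - ∫ y, U y‖ ^ 2 ≤ η⁻¹ * (Torus.eGradNormSq U).toReal :=
    mul_le_mul_of_nonneg_left hVG (inv_nonneg.2 hη.le)
  have i3 := mul_le_mul_of_nonneg_left (add_le_add i1 i2) hM0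
  rw [div_eq_mul_inv]
  linarith

end Summit.AnomalousDissipation.AnomalousDissipation.Theorems
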